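import Mathlib
import Summits.NavierStokesRegularity.NavierStokesRegularity.Theorems.TaoLadderRungThreeGappedFrontRobustTailStep
import HarnessLib

/-!
# `BarrierSoundness` (route `BarrierStepRungThree`), tools I: restriction of pseudo-flows, one-shell
  Grönwall bounds and the CLOCK along a pseudo-flow (chain rule for `v ∘ win ∘ S`)

Helper lemmas for item stmt-NavierStokesRegularity-23421 (`BarrierSoundness`) and its repaired form:
elementary calculus about Tao-type MODEL lattice pseudo-flows (`TaoCascade.PseudoFlowOn`, tree module
`RestartedCascadeFlows`):

* `pseudoFlowOn_restrict` — a pseudo-flow on `[0, τ]` is a pseudo-flow on `[0, t]` for `0 < t ≤ τ`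
  (the one-sided derivatives within `[0, t]` and `[0, τ]` agree on `[0, t]`);
* `sub_le_integral_of_derivWithin_le_on` — integrating `f' ≤ g` on an initial segment `[0, t] ⊆ [0, τ]`;
* `sqrt_energy_le_of_rate` — the square-root Grönwall bound of ONE shell: `F' ≤ ρ √(2F)` on `[0, t]`
  gives `√F(s) ≤ √F(0) + ρ s/√2`;
* `hasDerivWithinAt_clock` — the chain rule for the clock observable `u ↦ v(win S(u))` of a `C¹`
  function `v` of the window amplitudes; `clock_le_of_rate` — a uniform rate `≤ -γ` on `[0, t]` gives
  `v(win S(t')) ≤ v(win S(0)) - γ t'`; `clock_lt_right_of_rate_neg` — a negative rate at one time makes the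
  clock strictly smaller just after it (used at the left end of the first-exit bootstrap).

HONEST FRAMING: nothing here is a statement about the Navier–Stokes equations and nothing is asserted
about any table; the route's rung leaf (`TaoLadderRungThree.Target`, TL-M3) is not the summit Statement.
-/

noncomputable section

-- the sub-problem namespace `Summit.NavierStokesRegularity.NavierStokesRegularity` repeats the summit name by design (D-0017)
set_option linter.dupNamespace false

namespace Summit.NavierStokesRegularity.NavierStokesRegularity.Theorems

namespace BarrierSoundness

open Set MeasureTheory intervalIntegral Filter Topology
open Literature.Analysis.FluidPDE Literature.Analysis.FluidPDE.TaoCascade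

variable {m : ℕ} {τ ε₀ : ℝ} {α : Fin m → Fin m → Fin m → ℤ × ℤ × ℤ → ℝ} {κ₁ κ₂ : ℝ}
  {S₀ F₀ B₀ : Fin m → ℤ → ℝ} {S F : Fin m → ℤ → ℝ → ℝ}

/-! ### Restriction of a pseudo-flow to an initial segment -/

/-- On an initial segment `[0, t] ⊆ [0, τ]` (`t > 0`) the one-sided derivative within `[0, t]` of a
function that is `C¹` on `[0, τ]` agrees with its derivative within `[0, τ]`. [folklore] -/
theorem derivWithin_Icc_eq_of_le {f : ℝ → ℝ} {t : ℝ} (hf : ContDiffOn ℝ 1 f (Icc 0 τ)) (ht0 : 0 < t)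
    (ht : t ≤ τ) {s : ℝ} (hs : s ∈ Icc 0 t) :
    derivWithin f (Icc 0 t) s = derivWithin f (Icc 0 τ) s := by
  have hsτ : s ∈ Icc 0 τ := ⟨hs.1, hs.2.trans ht⟩
  have hd : DifferentiableWithinAt ℝ f (Icc 0 τ) s := (hf.differentiableOn one_ne_zero) s hsτ
  exact (hd.hasDerivWithinAt.mono (Icc_subset_Icc_right ht)).derivWithin (uniqueDiffOn_Icc ht0 s hs)

/-- **Restriction.** A pseudo-flow on `[0, τ]` restricts to a pseudo-flow on `[0, t]` for every
`0 < t ≤ τ` (same start state, slack and defect constants).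
[cite: Tao2016AveragedNS, §4 Lemma 4.1 (4.5), (4.8)–(4.10); cell vocabulary] -/
theorem pseudoFlowOn_restrict (h : PseudoFlowOn τ ε₀ α κ₁ κ₂ S₀ F₀ B₀ S F) {t : ℝ} (ht0 : 0 < t)
    (ht : t ≤ τ) : PseudoFlowOn t ε₀ α κ₁ κ₂ S₀ F₀ B₀ S F where
  contDiffOn_S i k := (h.contDiffOn_S i k).mono (Icc_subset_Icc_right ht)
  contDiffOn_F i k := (h.contDiffOn_F i k).mono (Icc_subset_Icc_right ht)
  nonneg_F i k s hs := h.nonneg_F i k s ⟨hs.1, hs.2.trans ht⟩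
  apriori_S := by
    obtain ⟨M, hM⟩ := h.apriori_S
    exact ⟨M, fun s hs i k => hM s ⟨hs.1, hs.2.trans ht⟩ i k⟩
  apriori_F := by
    obtain ⟨M, hM⟩ := h.apriori_F
    exact ⟨M, fun s hs i k => hM s ⟨hs.1, hs.2.trans ht⟩ i k⟩
  init_S := h.init_S
  init_F := h.init_F
  motion i k s hs := by
    rw [derivWithin_Icc_eq_of_le (h.contDiffOn_S i k) ht0 ht hs]
    exact h.motion i k s ⟨hs.1, hs.2.trans ht⟩
  energy i k s hs := by
    rw [derivWithin_Icc_eq_of_le (h.contDiffOn_F i k) ht0 ht hs]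
    exact h.energy i k s ⟨hs.1, hs.2.trans ht⟩
  defect_lower i k s hs := h.defect_lower i k s ⟨hs.1, hs.2.trans ht⟩
  defect_upper i k s hs := h.defect_upper i k s ⟨hs.1, hs.2.trans ht⟩

/-! ### Integrating a one-sided differential inequality on an initial segment -/

/-- **Integrating `f' ≤ g` on `[0, t] ⊆ [0, τ]`**: if `f` is `C¹` on `[0, τ]` (`τ > 0`), `g` is continuous
on `[0, τ]` and `derivWithin f [0,τ] ≤ g` on `[0, t]` (`t ≤ τ`), then `f(s) - f(0) ≤ ∫₀^s g` for every
`s ∈ [0, t]`. [folklore] -/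
theorem sub_le_integral_of_derivWithin_le_on {f g : ℝ → ℝ} {t s : ℝ} (hτ : 0 < τ)
    (hf : ContDiffOn ℝ 1 f (Icc 0 τ)) (hg : ContinuousOn g (Icc 0 τ)) (ht : t ≤ τ)
    (hle : ∀ u ∈ Icc 0 t, derivWithin f (Icc 0 τ) u ≤ g u) (hs : s ∈ Icc 0 t) :
    f s - f 0 ≤ ∫ u in (0 : ℝ)..s, g u := by
  have hsτ : s ≤ τ := hs.2.trans ht
  have hsub : Icc 0 s ⊆ Icc 0 τ := Icc_subset_Icc_right hsτ
  have hsub' : uIcc 0 s ⊆ Icc 0 τ := by rwa [uIcc_of_le hs.1]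
  have hcont : ContinuousOn f (Icc 0 s) := hf.continuousOn.mono hsub
  have hf'cont : ContinuousOn (derivWithin f (Icc 0 τ)) (Icc 0 τ) :=
    hf.continuousOn_derivWithin (uniqueDiffOn_Icc hτ) le_rfl
  have hint : IntervalIntegrable (derivWithin f (Icc 0 τ)) volume 0 s :=
    (hf'cont.mono hsub').intervalIntegrable
  have hgint : IntervalIntegrable g volume 0 s := (hg.mono hsub').intervalIntegrable
  have hderiv : ∀ x ∈ Ioo 0 s, HasDerivAt f (derivWithin f (Icc 0 τ) x) x := by
    intro x hx
    have hxτ : x < τ := hx.2.trans_le hsτ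
    have hxI : Icc 0 τ ∈ 𝓝 x := Icc_mem_nhds hx.1 hxτ
    have hd : DifferentiableWithinAt ℝ f (Icc 0 τ) x :=
      (hf.differentiableOn one_ne_zero) x ⟨hx.1.le, hxτ.le⟩
    rw [derivWithin_of_mem_nhds hxI]
    exact (hd.differentiableAt hxI).hasDerivAt
  have hftc := intervalIntegral.integral_eq_sub_of_hasDerivAt_of_le hs.1 hcont hderiv hint
  have hmono := intervalIntegral.integral_mono_on hs.1 hint hgint
    fun u hu => hle u ⟨hu.1, hu.2.trans hs.2⟩
  rw [hftc] at hmono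
  exact hmono

/-! ### The square-root Grönwall bound of one shell -/

/-- **One-shell square-root Grönwall bound.** Along a pseudo-flow on `[0, τ]` (`τ > 0`), if the energy of
the mode `(i, k)` obeys the rate bound `F' ≤ ρ √(2F)` on an initial segment `[0, t]` (`t ≤ τ`, `ρ ≥ 0`;
this is what the linear-in-`|S_k|` tail-rate clause of a barrier certificate gives through (4.9) and
`|S| ≤ √(2F)`), then `√(F_{i,k}(s)) ≤ √(F₀_{i,k}) + ρ s / √2` on `[0, t]` (Bihari; tree lemma
`GappedFrontRobust.sqrt_le_sqrt_add_half_integral`). [cite: Tao2016AveragedNS, §4 Lemma 4.1 (4.9)–(4.10)] -/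
theorem sqrt_energy_le_of_rate (h : PseudoFlowOn τ ε₀ α κ₁ κ₂ S₀ F₀ B₀ S F) (hτ : 0 < τ) {t : ℝ}
    (ht : t ≤ τ) (i : Fin m) (k : ℤ) {ρ : ℝ} (hρ : 0 ≤ ρ)
    (hrate : ∀ u ∈ Icc 0 t, derivWithin (F i k) (Icc 0 τ) u ≤ ρ * Real.sqrt (2 * F i k u)) :
    ∀ s ∈ Icc 0 t, Real.sqrt (F i k s) ≤ Real.sqrt (F₀ i k) + ρ * s / Real.sqrt 2 := by
  intro s hs
  have hsubt : Icc 0 t ⊆ Icc 0 τ := Icc_subset_Icc_right ht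
  have hFc : ContinuousOn (F i k) (Icc 0 τ) := (h.contDiffOn_F i k).continuousOn
  have hyc : ContinuousOn (F i k) (Icc 0 t) := hFc.mono hsubt
  -- the driving weight g := ρ √2 (constant) and the integral inequality
  have hgc : ContinuousOn (fun u => ρ * Real.sqrt (2 * F i k u)) (Icc 0 τ) :=
    continuousOn_const.mul ((continuousOn_const.mul hFc).sqrt)
  have hF0 : 0 ≤ F₀ i k := by
    have := h.nonneg_F i k 0 ⟨le_rfl, hτ.le⟩
    rwa [h.init_F i k] at this
  have hle : ∀ s' ∈ Icc 0 t, F i k s' ≤ F₀ i k +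
      ∫ u in (0 : ℝ)..s', (fun _ : ℝ => ρ * Real.sqrt 2) u * Real.sqrt (F i k u) := by
    intro s' hs'
    have h1 := sub_le_integral_of_derivWithin_le_on hτ (h.contDiffOn_F i k) hgc ht hrate hs'
    rw [h.init_F i k] at h1
    have h2 : ∫ u in (0 : ℝ)..s', ρ * Real.sqrt (2 * F i k u) =
        ∫ u in (0 : ℝ)..s', (fun _ : ℝ => ρ * Real.sqrt 2) u * Real.sqrt (F i k u) := by
      refine intervalIntegral.integral_congr fun u _ => ?_
      simp only [Real.sqrt_mul (show (0:ℝ) ≤ 2 by norm_num)]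
      ring
    linarith
  have hB := GappedFrontRobust.sqrt_le_sqrt_add_half_integral (τ := t) hyc continuousOn_const
    (fun u _ => by positivity) hF0 hle s hs
  have hint : ∫ u in (0 : ℝ)..s, (fun _ : ℝ => ρ * Real.sqrt 2) u = ρ * Real.sqrt 2 * s := by
    simp; ring
  rw [hint] at hB
  have hs2 : (0 : ℝ) < Real.sqrt 2 := by positivity
  have hsq : Real.sqrt 2 * Real.sqrt 2 = 2 := Real.mul_self_sqrt (by norm_num)
  calc Real.sqrt (F i k s) ≤ Real.sqrt (F₀ i k) + 1 / 2 * (ρ * Real.sqrt 2 * s) := hB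
    _ = Real.sqrt (F₀ i k) + ρ * s / Real.sqrt 2 := by
        congr 1
        rw [eq_div_iff hs2.ne']
        have e1 : (1 : ℝ) / 2 * (ρ * Real.sqrt 2 * s) * Real.sqrt 2 =
            ρ * s * (Real.sqrt 2 * Real.sqrt 2) / 2 := by ring
        rw [e1, hsq]
        ring

/-! ### The clock along a pseudo-flow -/

variable {n : ℕ}

/-- **Chain rule for the clock observable.** For a `C¹` function `v` of the window amplitudes
(`Fin m → Fin n → ℝ`, window `[kLo, kLo+n)`) and a pseudo-flow on `[0, τ]` (`τ > 0`), the observable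
`u ↦ v(k ↦ S_{·,kLo+k}(u))` has, within `[0, τ]` at every `s ∈ [0, τ]`, the derivative
`Dv(win S(s)) · (win S)'(s)` with `(win S)'_{i,j}(s) = derivWithin S_{i,kLo+j} [0,τ] s`.
[cite: Tao2016AveragedNS, §4 Lemma 4.1 (4.5) (the amplitudes are C¹); folklore chain rule] -/
theorem hasDerivWithinAt_clock (h : PseudoFlowOn τ ε₀ α κ₁ κ₂ S₀ F₀ B₀ S F)
    {v : (Fin m → Fin n → ℝ) → ℝ} (hv : ContDiff ℝ 1 v) (kLo : ℤ) {s : ℝ} (hs : s ∈ Icc 0 τ) :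
    HasDerivWithinAt (fun u => v (fun i j => S i (kLo + (j : ℕ)) u))
      ((fderiv ℝ v (fun i j => S i (kLo + (j : ℕ)) s))
        (fun i j => derivWithin (S i (kLo + (j : ℕ))) (Icc 0 τ) s)) (Icc 0 τ) s := by
  -- the window curve and its derivative
  have hcurve : HasDerivWithinAt (fun u => (fun i j => S i (kLo + (j : ℕ)) u : Fin m → Fin n → ℝ))
      (fun i j => derivWithin (S i (kLo + (j : ℕ))) (Icc 0 τ) s) (Icc 0 τ) s := by
    refine hasDerivWithinAt_pi.2 fun i => hasDerivWithinAt_pi.2 fun j => ?_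
    exact ((h.contDiffOn_S i (kLo + (j : ℕ))).differentiableOn one_ne_zero s hs).hasDerivWithinAt
  have hvd : HasFDerivAt v (fderiv ℝ v (fun i j => S i (kLo + (j : ℕ)) s))
      (fun i j => S i (kLo + (j : ℕ)) s) :=
    ((hv.differentiable one_ne_zero) _).hasFDerivAt
  exact hvd.comp_hasDerivWithinAt s hcurve

/-- **Uniform decrease of the clock.** If along a pseudo-flow on `[0, τ]` (`τ > 0`) the clock rate
`Dv(win S(u)) · (win S)'(u)` is `≤ -γ` at every `u` of an initial segment `[0, t]` (`t ≤ τ`), then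
`v(win S(s)) ≤ v(win S(0)) - γ s` for every `s ∈ [0, t]` (Prajna–Rantzer's clock in dimension one:
`u ↦ v(win S(u)) + γ u` is antitone). [cite: Tao2016AveragedNS, §4 Lemma 4.1 (4.5); folklore] -/
theorem clock_le_of_rate (h : PseudoFlowOn τ ε₀ α κ₁ κ₂ S₀ F₀ B₀ S F)
    {v : (Fin m → Fin n → ℝ) → ℝ} (hv : ContDiff ℝ 1 v) (kLo : ℤ) {γ t : ℝ} (ht : t ≤ τ)
    (hrate : ∀ u ∈ Icc 0 t, (fderiv ℝ v (fun i j => S i (kLo + (j : ℕ)) u))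
      (fun i j => derivWithin (S i (kLo + (j : ℕ))) (Icc 0 τ) u) ≤ -γ) :
    ∀ s ∈ Icc 0 t, v (fun i j => S i (kLo + (j : ℕ)) s) ≤ v (fun i j => S i (kLo + (j : ℕ)) 0) - γ * s := by
  intro s hs
  set V : ℝ → ℝ := fun u => v (fun i j => S i (kLo + (j : ℕ)) u) with hV
  set V' : ℝ → ℝ := fun u => (fderiv ℝ v (fun i j => S i (kLo + (j : ℕ)) u))
      (fun i j => derivWithin (S i (kLo + (j : ℕ))) (Icc 0 τ) u) with hV'
  have hder : ∀ u ∈ Icc 0 τ, HasDerivWithinAt V (V' u) (Icc 0 τ) u := fun u hu =>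
    hasDerivWithinAt_clock h hv kLo hu
  have hsubt : Icc 0 t ⊆ Icc 0 τ := Icc_subset_Icc_right ht
  have hcont : ContinuousOn V (Icc 0 t) := fun u hu =>
    ((hder u (hsubt hu)).continuousWithinAt).mono hsubt
  -- W u := V u + γ u is antitone on [0, t]
  have hW : AntitoneOn (fun u => V u + γ * u) (Icc 0 t) := by
    apply antitoneOn_of_hasDerivWithinAt_nonpos (convex_Icc 0 t) (hcont.add (by fun_prop))
      (f' := fun u => V' u + γ)
    · intro u hu
      rw [interior_Icc] at hu
      have hu' : u ∈ Icc 0 τ := ⟨hu.1.le, hu.2.le.trans ht⟩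
      have h1 : HasDerivWithinAt V (V' u) (interior (Icc 0 t)) u := by
        rw [interior_Icc]
        exact (hder u hu').mono (Ioo_subset_Icc_self.trans hsubt)
      exact h1.add ((hasDerivWithinAt_id u _).const_mul γ |>.congr_deriv (by simp))
    · intro u hu
      rw [interior_Icc] at hu
      have := hrate u ⟨hu.1.le, hu.2.le⟩
      simp only [hV'] at this ⊢
      linarith
  have ht0 : 0 ≤ t := hs.1.trans hs.2
  have hmono := hW (left_mem_Icc.mpr ht0) hs hs.1
  simp only [mul_zero, add_zero] at hmono
  simp only [hV] at hmono ⊢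
  linarith

/-- **A negative rate pushes the clock down just after.** If at some `s ∈ [0, τ)` the clock rate is
`≤ -γ < 0`, then for some `δ > 0` the clock is strictly below its value at `s` on `(s, s+δ) ∩ [0, τ]`
(right slope limit). Used at the left end of the first-exit bootstrap, where `v(win S(0)) ≤ 0` need not
be strict. [folklore] -/
theorem clock_lt_right_of_rate_neg (h : PseudoFlowOn τ ε₀ α κ₁ κ₂ S₀ F₀ B₀ S F)
    {v : (Fin m → Fin n → ℝ) → ℝ} (hv : ContDiff ℝ 1 v) (kLo : ℤ) {γ s : ℝ} (hγ : 0 < γ)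
    (hs : s ∈ Icc 0 τ)
    (hrate : (fderiv ℝ v (fun i j => S i (kLo + (j : ℕ)) s))
      (fun i j => derivWithin (S i (kLo + (j : ℕ))) (Icc 0 τ) s) ≤ -γ) :
    ∃ δ > 0, ∀ u ∈ Icc 0 τ, s < u → u < s + δ →
      v (fun i j => S i (kLo + (j : ℕ)) u) < v (fun i j => S i (kLo + (j : ℕ)) s) := by
  set V : ℝ → ℝ := fun u => v (fun i j => S i (kLo + (j : ℕ)) u) with hV
  have hder := hasDerivWithinAt_clock h hv kLo hs
  have hneg : (fderiv ℝ v (fun i j => S i (kLo + (j : ℕ)) s))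
      (fun i j => derivWithin (S i (kLo + (j : ℕ))) (Icc 0 τ) s) < 0 := by linarith
  have hev := hder.limsup_slope_le hneg
  rw [Filter.Eventually, mem_nhdsWithin_iff_exists_mem_nhds_inter] at hev
  obtain ⟨U, hU, hUsub⟩ := hev
  obtain ⟨δ, hδ, hball⟩ := Metric.mem_nhds_iff.mp hU
  refine ⟨δ, hδ, fun u hu hsu hus => ?_⟩
  have huU : u ∈ U := hball (by
    rw [Metric.mem_ball, Real.dist_eq, abs_lt]
    constructor <;> linarith)
  have hne : u ≠ s := ne_of_gt hsu
  have hmem : u ∈ U ∩ (Icc 0 τ \ {s}) := ⟨huU, hu, hne⟩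
  have hslope : slope V s u < 0 := hUsub hmem
  rw [slope_def_field] at hslope
  have hpos : 0 < u - s := by linarith
  have : V u - V s < 0 := by
    by_contra hcon
    push Not at hcon
    have := div_nonneg hcon hpos.le
    linarith
  simp only [hV] at this
  linarith

end BarrierSoundness

end Summit.NavierStokesRegularity.NavierStokesRegularity.Theorems

end
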